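import Summits.AtomisticToContinuum.Crystallization.Theses.ChessboardParticlePlanes
import Summits.AtomisticToContinuum.Crystallization.Theorems.PhononStability.Negative.Mirror
import Literature.MathematicalPhysics.StatisticalMechanics.LennardJonesClusters

/-!
# Route ChessboardParticlePlanes — item 6712 `LayerConfinedCompetitors`: the projection estimate

Helper file for item `stmt-AtomisticToContinuum-6712` (`LayerConfinedCompetitors`), the energetic
half of the laminar periodisation `LjLaminarWindows → LayerConfinedCompetitors`: moving every
particle of a `7/10`-separated finite configuration by at most `η ≤ 1/60` (onto its plane)
keeps the configuration `2/3`-separated and raises its Lennard-Jones energy by at most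
`55250 · η` per particle.

* `abs_deriv_lennardJones_le` — `|V′(s)| = |−s⁻¹³ + s⁻⁷| ≤ 19 s⁻⁶` for `s ≥ 2/3`;
* `abs_lennardJones_sub_le_of_le` — mean value: `|V(b) − V(a)| ≤ 19 a⁻⁶ (b − a)`, `2/3 ≤ a ≤ b`;
* `abs_lennardJones_sub_le_of_near` — `|V(r) − V(d)| ≤ 52 η d⁻⁶` for `d ≥ 7/10`,
  `|r − d| ≤ 2η`, `η ≤ 1/60`;
* `siteEnergy_le_of_near`, `interactionEnergy_le_of_near` — summed with the shell bound
  `Σ_{k ≠ j} d_jk⁻⁶ ≤ 250 (10/7)⁶` (`sum_inv_pow_six_le`): site energies move by `≤ 110500 η`,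
  the total energy by `≤ 55250 η · m`;
* `two_thirds_le_dist_of_near` — the moved configuration is `2/3`-separated.
-/

namespace Summit.AtomisticToContinuum.Crystallization.Theorems.LayerConfined

open Literature.MathematicalPhysics.StatisticalMechanics

/-- **Derivative bound.** `|V′(s)| = |−s⁻¹³ + s⁻⁷| ≤ s⁻¹³ + s⁻⁷ ≤ ((3/2)⁷ + 3/2) s⁻⁶ ≤ 19 s⁻⁶`
for `s ≥ 2/3`. [folklore] -/
theorem abs_deriv_lennardJones_le {s : ℝ} (hs : (2 : ℝ) / 3 ≤ s) :
    |-(s⁻¹) ^ 13 + (s⁻¹) ^ 7| ≤ 19 * (s⁻¹) ^ 6 := by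
  have hs0 : 0 < s := by linarith
  have hu0 : 0 ≤ s⁻¹ := inv_nonneg.2 hs0.le
  have hu : s⁻¹ ≤ 3 / 2 := by
    rw [inv_le_comm₀ hs0 (by norm_num)]
    linarith
  have h6 : 0 ≤ (s⁻¹) ^ 6 := pow_nonneg hu0 6
  have h7 : (s⁻¹) ^ 7 ≤ 3 / 2 * (s⁻¹) ^ 6 := by
    calc (s⁻¹) ^ 7 = s⁻¹ * (s⁻¹) ^ 6 := by ring
      _ ≤ 3 / 2 * (s⁻¹) ^ 6 := by gcongr
  have h13 : (s⁻¹) ^ 13 ≤ (3 / 2) ^ 7 * (s⁻¹) ^ 6 := by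
    calc (s⁻¹) ^ 13 = (s⁻¹) ^ 7 * (s⁻¹) ^ 6 := by ring
      _ ≤ (3 / 2) ^ 7 * (s⁻¹) ^ 6 := by gcongr
  have hnn7 : 0 ≤ (s⁻¹) ^ 7 := pow_nonneg hu0 7
  have hnn13 : 0 ≤ (s⁻¹) ^ 13 := pow_nonneg hu0 13
  rw [abs_le]
  constructor <;> nlinarith

/-- **Mean value estimate.** For `2/3 ≤ a ≤ b`: `|V(b) − V(a)| ≤ 19 a⁻⁶ (b − a)` (Lagrange on
`[a, b]` with `hasDerivAt_lennardJones`, the derivative bound, and `c⁻⁶ ≤ a⁻⁶` for `c ≥ a`).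
[folklore] -/
theorem abs_lennardJones_sub_le_of_le {a b : ℝ} (ha : (2 : ℝ) / 3 ≤ a) (hab : a ≤ b) :
    |lennardJones b - lennardJones a| ≤ 19 * (a⁻¹) ^ 6 * (b - a) := by
  rcases hab.eq_or_lt with rfl | hlt
  · simp
  have ha0 : 0 < a := by linarith
  have hcont : ContinuousOn lennardJones (Set.Icc a b) :=
    continuousOn_lennardJones.mono fun s hs => by
      simp only [Set.mem_compl_iff, Set.mem_singleton_iff]
      exact (ha0.trans_le hs.1).ne'
  have hder : ∀ s ∈ Set.Ioo a b, HasDerivAt lennardJones (-(s⁻¹) ^ 13 + (s⁻¹) ^ 7) s :=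
    fun s hs => PhononStabilityNegative.hasDerivAt_lennardJones (ha0.trans hs.1).ne'
  obtain ⟨c, hc, hceq⟩ := exists_hasDerivAt_eq_slope lennardJones
    (fun s => -(s⁻¹) ^ 13 + (s⁻¹) ^ 7) hlt hcont hder
  have hVeq : lennardJones b - lennardJones a = (-(c⁻¹) ^ 13 + (c⁻¹) ^ 7) * (b - a) := by
    rw [hceq]
    field_simp
  have hc23 : (2 : ℝ) / 3 ≤ c := by linarith [hc.1]
  have hbd := abs_deriv_lennardJones_le hc23
  have hca : (c⁻¹) ^ 6 ≤ (a⁻¹) ^ 6 :=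
    pow_le_pow_left₀ (inv_nonneg.2 (by linarith [hc.1])) (inv_anti₀ ha0 hc.1.le) 6
  rw [hVeq, abs_mul, abs_of_pos (sub_pos.2 hlt)]
  have h19 : |-(c⁻¹) ^ 13 + (c⁻¹) ^ 7| ≤ 19 * (a⁻¹) ^ 6 := hbd.trans (by gcongr)
  exact mul_le_mul_of_nonneg_right h19 (sub_nonneg.2 hab)

/-- **Pair estimate.** For `d ≥ 7/10`, `|r − d| ≤ 2η`, `η ≤ 1/60`:
`|V(r) − V(d)| ≤ 52 η d⁻⁶` (the interval `[min r d, max r d]` lies above `d − 1/30 ≥ (20/21) d`,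
so `min⁻⁶ ≤ (21/20)⁶ d⁻⁶ ≤ (27/20) d⁻⁶`, and `19 · (27/20) · 2 ≤ 52`). [folklore] -/
theorem abs_lennardJones_sub_le_of_near {d r η : ℝ} (hd : (7 : ℝ) / 10 ≤ d) (hη : η ≤ 1 / 60)
    (hr : |r - d| ≤ 2 * η) :
    |lennardJones r - lennardJones d| ≤ 52 * η * (d⁻¹) ^ 6 := by
  have hη0 : 0 ≤ η := by linarith [abs_nonneg (r - d)]
  obtain ⟨hr1, hr2⟩ := abs_le.1 hr
  have hd0 : 0 < d := by linarith
  have hd6 : 0 ≤ (d⁻¹) ^ 6 := pow_nonneg (inv_nonneg.2 hd0.le) 6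
  -- the generic step on an interval `[a, b]` with `d - 2η ≤ a`, `b - a ≤ 2η`
  have step : ∀ a b : ℝ, d - 2 * η ≤ a → a ≤ b → b - a ≤ 2 * η →
      |lennardJones b - lennardJones a| ≤ 52 * η * (d⁻¹) ^ 6 := by
    intro a b ha hab hba
    have ha' : (20 : ℝ) / 21 * d ≤ a := by linarith
    have ha23 : (2 : ℝ) / 3 ≤ a := by linarith
    have ha0 : 0 < a := by linarith
    have key := abs_lennardJones_sub_le_of_le ha23 hab
    have hinv : a⁻¹ ≤ 21 / 20 * d⁻¹ := by
      rw [show (21 : ℝ) / 20 * d⁻¹ = ((20 / 21) * d)⁻¹ by rw [mul_inv, inv_div]]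
      exact inv_anti₀ (by positivity) ha'
    have h6 : (a⁻¹) ^ 6 ≤ 27 / 20 * (d⁻¹) ^ 6 :=
      calc (a⁻¹) ^ 6 ≤ (21 / 20 * d⁻¹) ^ 6 := pow_le_pow_left₀ (inv_nonneg.2 ha0.le) hinv 6
        _ = (21 / 20) ^ 6 * (d⁻¹) ^ 6 := mul_pow _ _ _
        _ ≤ 27 / 20 * (d⁻¹) ^ 6 := by gcongr; norm_num
    calc |lennardJones b - lennardJones a| ≤ 19 * (a⁻¹) ^ 6 * (b - a) := key
      _ ≤ 19 * (27 / 20 * (d⁻¹) ^ 6) * (2 * η) := by gcongr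
      _ ≤ 52 * η * (d⁻¹) ^ 6 := by nlinarith [mul_nonneg hη0 hd6]
  rcases le_total r d with h | h
  · rw [abs_sub_comm]
    exact step r d (by linarith) h (by linarith)
  · exact step d r (by linarith) h (by linarith)

variable {m : ℕ}

/-- **Moved distances.** If every particle moves by at most `η`, every pair distance moves by
at most `2η`. [folklore] -/
theorem abs_dist_sub_dist_le {w w' : Fin m → EuclideanSpace ℝ (Fin 3)} {η : ℝ} (h : ∀ j, dist (w' j) (w j) ≤ η)
    (j k : Fin m) : |dist (w' j) (w' k) - dist (w j) (w k)| ≤ 2 * η := by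
  have h1 : |dist (w' j) (w' k) - dist (w j) (w k)| ≤ dist (w' j) (w j) + dist (w' k) (w k) := by
    rw [← Real.dist_eq]
    exact dist_dist_dist_le _ _ _ _
  linarith [h j, h k]

/-- **Separation survives.** A `7/10`-separated configuration whose pair distances move by
`≤ 2η ≤ 1/30` stays `2/3`-separated. [folklore] -/
theorem two_thirds_le_dist_of_near {w w' : Fin m → EuclideanSpace ℝ (Fin 3)} {η : ℝ} (hη : η ≤ 1 / 60)
    (hsep : ∀ j k, j ≠ k → (7 : ℝ) / 10 ≤ dist (w j) (w k))
    (hnear : ∀ j k, |dist (w' j) (w' k) - dist (w j) (w k)| ≤ 2 * η) {j k : Fin m}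
    (hjk : j ≠ k) : (2 : ℝ) / 3 ≤ dist (w' j) (w' k) := by
  have h1 := hsep j k hjk
  have h2 := (abs_le.1 (hnear j k)).1
  linarith

/-- **Site energies move by `≤ 110500 η`.** For a `7/10`-separated configuration `w` of `ℝ³` and
a configuration `w'` with pair distances within `2η` (`η ≤ 1/60`) of those of `w`:
`𝓔ʲ(w') ≤ 𝓔ʲ(w) + 52 η Σ_{k ≠ j} d_jk⁻⁶ ≤ 𝓔ʲ(w) + 52 · 250 · (10/7)⁶ η ≤ 𝓔ʲ(w) + 110500 η`
(pair estimate + shell bound `sum_inv_pow_six_le`). [folklore] -/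
theorem siteEnergy_le_of_near {w w' : Fin m → EuclideanSpace ℝ (Fin 3)} {η : ℝ} (hη : η ≤ 1 / 60)
    (hsep : ∀ j k, j ≠ k → (7 : ℝ) / 10 ≤ dist (w j) (w k))
    (hnear : ∀ j k, |dist (w' j) (w' k) - dist (w j) (w k)| ≤ 2 * η) (j : Fin m) :
    siteEnergy lennardJones w' j ≤ siteEnergy lennardJones w j + 110500 * η := by
  have hη0 : 0 ≤ η := by
    have := hnear j j
    simp only [dist_self, sub_zero, abs_zero] at this
    linarith
  unfold siteEnergy
  have hterm : ∀ k ∈ Finset.univ.erase j, lennardJones (dist (w' j) (w' k)) ≤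
      lennardJones (dist (w j) (w k)) + 52 * η * ((dist (w j) (w k))⁻¹) ^ 6 := by
    intro k hk
    have hjk : j ≠ k := (Finset.ne_of_mem_erase hk).symm
    have h := abs_lennardJones_sub_le_of_near (hsep j k hjk) hη (hnear j k)
    linarith [(abs_le.1 h).2]
  have hshell := sum_inv_pow_six_le w (by norm_num : (0 : ℝ) < 7 / 10) hsep j
  calc ∑ k ∈ Finset.univ.erase j, lennardJones (dist (w' j) (w' k))
      ≤ ∑ k ∈ Finset.univ.erase j,
          (lennardJones (dist (w j) (w k)) + 52 * η * ((dist (w j) (w k))⁻¹) ^ 6) :=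
        Finset.sum_le_sum hterm
    _ = ∑ k ∈ Finset.univ.erase j, lennardJones (dist (w j) (w k)) +
          52 * η * ∑ k ∈ Finset.univ.erase j, ((dist (w j) (w k))⁻¹) ^ 6 := by
        rw [Finset.sum_add_distrib, Finset.mul_sum]
    _ ≤ ∑ k ∈ Finset.univ.erase j, lennardJones (dist (w j) (w k)) +
          52 * η * (250 * (7 / 10 : ℝ)⁻¹ ^ 6) := by gcongr
    _ ≤ ∑ k ∈ Finset.univ.erase j, lennardJones (dist (w j) (w k)) + 110500 * η := by
        norm_num
        nlinarith

/-- **The energy moves by `≤ 55250 η` per particle.** Under the same hypotheses,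
`𝓔(w') ≤ 𝓔(w) + 55250 · η · m` (`2𝓔 = Σ_j 𝓔ʲ`). [folklore] -/
theorem interactionEnergy_le_of_near {w w' : Fin m → EuclideanSpace ℝ (Fin 3)} {η : ℝ} (hη : η ≤ 1 / 60)
    (hsep : ∀ j k, j ≠ k → (7 : ℝ) / 10 ≤ dist (w j) (w k))
    (hnear : ∀ j k, |dist (w' j) (w' k) - dist (w j) (w k)| ≤ 2 * η) :
    interactionEnergy lennardJones w' ≤ interactionEnergy lennardJones w + 55250 * η * m := by
  have h2 := two_mul_interactionEnergy lennardJones w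
  have h2' := two_mul_interactionEnergy lennardJones w'
  have hsum : ∑ j, siteEnergy lennardJones w' j ≤
      ∑ j, (siteEnergy lennardJones w j + 110500 * η) :=
    Finset.sum_le_sum fun j _ => siteEnergy_le_of_near hη hsep hnear j
  rw [Finset.sum_add_distrib, Finset.sum_const, Finset.card_univ, Fintype.card_fin,
    nsmul_eq_mul] at hsum
  linarith

end Summit.AtomisticToContinuum.Crystallization.Theorems.LayerConfined
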